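import Literature.MathematicalPhysics.QuantumFieldTheory.U1GinibreComparison
import Literature.Probability.LatticeModels.GinibreCharacterExpansion
import HarnessLib

/-!
# The dual (flux) representation of free-boundary `U(1)` lattice gauge theory on `ℤ^d`

Proof companion of `U1WeakCouplingD4.lean` (named fact
`Literature.MathematicalPhysics.QuantumFieldTheory.FrohlichSpencerU1PerimeterLawD4`, the
Fröhlich–Spencer / Guth perimeter law): the first step of every printed proof of the perimeter law
— the duality (character, Fourier) transformation of the `U(1)` theory to a model of integer
plaquette fields (Fröhlich–Spencer 1982 §2.3; Guth 1980 §II) — carried out for the tree's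
free-boundary Wilson-action theory `zdWilsonMeasure u1Rep β Λ` of `Sweep1` on an ARBITRARY finite
region `Λ ⊆ ℤ^d`, in any dimension. Everything is PROVED; no named fact is introduced (D-0026).

* `zdHaar.instIsHaarMeasure` — the a priori measure `dg_∞ = ∏_{bonds of ℤ^d} dHaar` (`Sweep1.zdHaar`,
  an infinite product) is a Haar measure on the compact group `G^{E(ℤ^d)}` of configurations
  (left invariance factor by factor, positivity on open cylinders), for every compact group `G`;
  this makes Ginibre's inequality (`GinibreInequality.lean`) and the character expansion
  (`GinibreCharacterExpansion.lean`) available directly on `ℤ^d`, without the detour through tori.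
* `monChar k` — the monomial character `U ↦ ∏ₑ U_e^{k(e)}` of `U(1)^{E(ℤ^d)}` attached to a
  finitely supported integer 1-chain `k : ZdEdge d →₀ ℤ` (additive in `k`), and
  `monChar_eq_one_iff : monChar k = 1 ↔ k = 0` (the character lattice of a torus).
* The integer 1-chains of the elementary holonomies: `plaqCurrent p` (the boundary `∂p` of a
  plaquette, `monChar (plaqCurrent p) U = U_p`), `lineCurrent`, `loopCurrent x i j R T` (the
  boundary current `J_γ` of the `R × T` rectangle `γ`, `monChar (loopCurrent …) U = U_γ`).
* `zdExpect_u1_eq_ginibreExpect` — the free-boundary `U(1)` theory of `Λ` is the Ginibre model on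
  `(U(1)^{E(ℤ^d)}, dg_∞)` with characters the plaquette holonomies of `Λ` and constant coupling `β`.
* `zdU1DualPartition β Λ J = ∑_{m ∈ ℤ^{P(Λ)}, ∑ₚ mₚ ∂p = J} ∏ₚ I_{mₚ}(β)` and the **dual
  representation** `zdExpect_u1_wilsonLoop_eq_dual`:
  `⟨W_γ⟩_{Λ,β} = Z_Λ(J_γ) / Z_Λ(0)` with `Z_Λ(J) = zdU1DualPartition β Λ J` — the free-boundary
  Wilson-loop expectation as the ratio of the flux sums over integer plaquette fields on `Λ` with
  boundary `J_γ`, resp. closed, weighted by the modified Bessel coefficients `∏ₚ I_{mₚ}(β)`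
  (Fröhlich–Spencer 1982 (2.24)-type formula; for Wilson's action this is the representation
  `Z(X) = ∑_{n : δn = 0} ∏ₚ I_β(nₚ) e^{i(n,X)}` printed by Cirigliano–Paffuti 1999 §1.2, whose
  `δ` on integer 2-forms is the boundary `m ↦ ∑ₚ mₚ ∂p` below; coefficients as in Montvay–Münster
  1994 (3.171)–(3.172)); `integral_exp_neg_mul_zdWilsonAction_u1` (`Z_{Λ,β} = e^{-β|P(Λ)|} Z_Λ(0)`),
  `zdU1DualPartition_neg` (`Z_Λ(-J) = Z_Λ(J)`).

The next step of the printed proofs (Cirigliano–Paffuti §1.2, second display: on the dual lattice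
the closed integer 2-forms are `dA` for integer 1-forms `A`, summed over gauge classes `[A]`;
Fröhlich–Spencer (2.25)–(2.31)) is not in this file.

## References

* V. Cirigliano, G. Paffuti, *Magnetic monopoles in U(1)₄ lattice gauge theory with Wilson
  action*, Comm. Math. Phys. 200 (1999) 381–398, arXiv:hep-th/9707219, §1.2 (dual representation
  of the Wilson-action model: "Performing a Fourier analysis … `Z(X) = ∑_{n : δn = 0} ∏ₚ I_β(nₚ)
  e^{i(n,X)}` … With `I_β(n)` we indicate the modified Bessel functions of order `n` evaluated in
  `β`"). [CiriglianoPaffuti1999]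
* J. Fröhlich, T. Spencer, Comm. Math. Phys. 83 (1982) 411–454, §2.3 (duality transformation to
  the `ℤ`-valued dual model; Villain action). [FrohlichSpencerCMP1982]
* A. H. Guth, Phys. Rev. D 21 (1980) 2291–2307, §II. [Guth1980]
* I. Montvay, G. Münster, *Quantum Fields on a Lattice* (CUP 1994), §3.2.7 (3.169)–(3.172)
  (character expansion of the `U(1)` Wilson weight, `c_n = I_n(β)e^{-β}`). [MontvayMunster1994]
-/

noncomputable section

open MeasureTheory Filter Finset
open scoped Topology BigOperators
open Literature.Probability.LatticeModels Literature.MathematicalPhysics.QuantumLattice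

namespace Literature.MathematicalPhysics.QuantumFieldTheory

open AreaLaw

/-! ### `dg_∞` is a Haar probability measure on the configuration group -/

section Haar

variable {d : ℕ} {G : Type*} [Group G] [TopologicalSpace G] [IsTopologicalGroup G] [CompactSpace G]
  [MeasurableSpace G] [BorelSpace G]

/-- `dg_∞` is left invariant: left multiplication by a configuration is coordinatewise left
multiplication, which preserves every Haar factor. [folklore] -/
instance zdHaar.instIsMulLeftInvariant : (zdHaar d G).IsMulLeftInvariant := by
  refine ⟨fun V => ?_⟩
  have h := Literature.Probability.LatticeModels.map_pi_infinitePi (ι := ZdEdge d) (haarProbability G)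
    (f := fun e g => V e * g) (fun e => measurable_const_mul (V e))
    (fun e => map_mul_left_eq_self _ (V e))
  exact h

/-- `dg_∞` charges every non-empty open set: it contains an open cylinder, whose measure is a finite
product of Haar measures of non-empty open sets. [folklore] -/
instance zdHaar.instIsOpenPosMeasure : (zdHaar d G).IsOpenPosMeasure := by
  refine ⟨fun U hU hne => ?_⟩
  obtain ⟨x, hx⟩ := hne
  obtain ⟨I, u, hu, hsub⟩ := isOpen_pi_iff.1 hU x hx
  have hpos : zdHaar d G ((I : Set (ZdEdge d)).pi u) ≠ 0 := by
    unfold zdHaar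
    rw [Measure.infinitePi_pi (fun _ : ZdEdge d => haarProbability G) fun e he => (hu e he).1.measurableSet]
    exact Finset.prod_ne_zero_iff.2 fun e he =>
      ((hu e he).1.measure_pos (haarProbability G) ⟨x e, (hu e he).2⟩).ne'
  exact fun h0 => hpos (measure_mono_null hsub h0)

/-- **`dg_∞` is a Haar measure** on the compact group `G^{E(ℤ^d)}`. [folklore] -/
instance zdHaar.instIsHaarMeasure : (zdHaar d G).IsHaarMeasure :=
  { lt_top_of_isCompact := fun _ _ => measure_lt_top _ _
    toIsOpenPosMeasure := inferInstance }

end Haar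

/-! ### Monomial characters of `U(1)^{E(ℤ^d)}` -/

section MonChar

variable {d : ℕ}

/-- The **monomial character** `U ↦ ∏ₑ U_e^{k(e)}` of the configuration group `U(1)^{E(ℤ^d)}`
attached to a finitely supported integer 1-chain `k`. [folklore] -/
def monChar (k : ZdEdge d →₀ ℤ) : ZdGaugeConfig d Circle →ₜ* Circle where
  toFun U := k.prod fun e n => U e ^ n
  map_one' := by simp [Finsupp.prod]
  map_mul' U V := by simp [Finsupp.prod, mul_zpow, Finset.prod_mul_distrib]
  continuous_toFun := by
    simp only [Finsupp.prod]
    exact continuous_finsetProd _ fun e _ => (continuous_apply e).zpow (k e)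

/-- `monChar k U = ∏_{e ∈ supp k} U_e^{k(e)}`. [folklore] -/
theorem monChar_apply (k : ZdEdge d →₀ ℤ) (U : ZdGaugeConfig d Circle) :
    monChar k U = k.prod fun e n => U e ^ n := rfl

/-- `monChar 0 = 1`. [folklore] -/
@[simp] theorem monChar_zero_apply (U : ZdGaugeConfig d Circle) :
    monChar (0 : ZdEdge d →₀ ℤ) U = 1 := by
  simp [monChar_apply]

/-- Additivity: `monChar (k + k') = monChar k · monChar k'`. [folklore] -/
theorem monChar_add_apply (k k' : ZdEdge d →₀ ℤ) (U : ZdGaugeConfig d Circle) :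
    monChar (k + k') U = monChar k U * monChar k' U := by
  simp only [monChar_apply]
  exact Finsupp.prod_add_index' (fun e => zpow_zero _) fun e b₁ b₂ => zpow_add _ _ _

/-- `monChar (-k) = (monChar k)⁻¹`. [folklore] -/
theorem monChar_neg_apply (k : ZdEdge d →₀ ℤ) (U : ZdGaugeConfig d Circle) :
    monChar (-k) U = (monChar k U)⁻¹ := by
  simp only [monChar_apply]
  rw [Finsupp.prod_neg_index fun e => zpow_zero _]
  simp only [zpow_neg, Finsupp.prod, Finset.prod_inv_distrib]

/-- `monChar (k - k') = monChar k · (monChar k')⁻¹`. [folklore] -/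
theorem monChar_sub_apply (k k' : ZdEdge d →₀ ℤ) (U : ZdGaugeConfig d Circle) :
    monChar (k - k') U = monChar k U * (monChar k' U)⁻¹ := by
  rw [sub_eq_add_neg, monChar_add_apply, monChar_neg_apply]

/-- `monChar (single e n) U = U_e^n`. [folklore] -/
@[simp] theorem monChar_single_apply (e : ZdEdge d) (n : ℤ) (U : ZdGaugeConfig d Circle) :
    monChar (Finsupp.single e n) U = U e ^ n := by
  rw [monChar_apply, Finsupp.prod_single_index (zpow_zero _)]

/-- `monChar (∑ₐ kₐ) = ∏ₐ monChar kₐ`. [folklore] -/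
theorem monChar_sum_apply {α : Type*} (s : Finset α) (f : α → ZdEdge d →₀ ℤ)
    (U : ZdGaugeConfig d Circle) : monChar (∑ a ∈ s, f a) U = ∏ a ∈ s, monChar (f a) U := by
  simp only [monChar_apply]
  exact (Finsupp.prod_finsetSum_index (fun e => zpow_zero _) fun e b₁ b₂ => zpow_add _ _ _).symm

/-- `monChar (n • k) = (monChar k)^n`. [folklore] -/
theorem monChar_zsmul_apply (n : ℤ) (k : ZdEdge d →₀ ℤ) (U : ZdGaugeConfig d Circle) :
    monChar (n • k) U = (monChar k U) ^ n := by
  rw [monChar_apply, monChar_apply,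
    Finsupp.prod_of_support_subset (n • k) Finsupp.support_smul (fun e m => U e ^ m)
      fun e _ => zpow_zero _, Finsupp.prod, ← Finset.prod_zpow]
  refine Finset.prod_congr rfl fun e _ => ?_
  rw [Finsupp.smul_apply, smul_eq_mul, mul_comm, zpow_mul]

/-- **The character lattice of the torus `U(1)^{E(ℤ^d)}`**: a monomial character is trivial iff
its exponent chain vanishes (test it on the one-parameter subgroup `t ↦ e^{it}` placed on a bond
`e` with `k(e) ≠ 0`, at `t = π/k(e)`). [folklore] -/
theorem monChar_eq_one_iff (k : ZdEdge d →₀ ℤ) : monChar k = 1 ↔ k = 0 := by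
  constructor
  · intro h
    by_contra hk
    obtain ⟨e, he⟩ : ∃ e, k e ≠ 0 := by
      by_contra h'
      push Not at h'
      exact hk (Finsupp.ext h')
    set n : ℤ := k e with hn
    set U₀ : ZdGaugeConfig d Circle := Pi.mulSingle e (Circle.exp (Real.pi / n)) with hU₀
    have h1 : monChar k U₀ = Circle.exp (Real.pi / n) ^ n := by
      rw [monChar_apply, Finsupp.prod, Finset.prod_eq_single e]
      · rw [hU₀, Pi.mulSingle_eq_same]
      · intro e' _ hne
        rw [hU₀, Pi.mulSingle_eq_of_ne hne, one_zpow]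
      · intro hmem
        exact absurd (Finsupp.mem_support_iff.2 he) hmem
    have h2 : monChar k U₀ = 1 := by rw [h]; rfl
    have h3 : ((Circle.exp (Real.pi / n) ^ n : Circle) : ℂ) = 1 := by
      rw [← h1, h2, Circle.coe_one]
    rw [Circle.coe_zpow, Circle.coe_exp, ← Complex.exp_int_mul] at h3
    have h4 : (n : ℂ) * (((Real.pi / n : ℝ) : ℂ) * Complex.I) = Real.pi * Complex.I := by
      have hn0 : (n : ℂ) ≠ 0 := by exact_mod_cast he
      push_cast
      field_simp
    rw [h4, Complex.exp_pi_mul_I] at h3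
    norm_num at h3
  · rintro rfl
    ext U
    simp

end MonChar

/-! ### The integer 1-chains of plaquettes, straight lines and rectangular loops -/

section Currents

variable {d : ℕ}

/-- The boundary chain `∂p = [x,x+eᵢ] + [x+eᵢ,·+eⱼ] - [x+eⱼ,·+eᵢ] - [x,x+eⱼ]` of the plaquette
`p = (x; i, j)` (the exponents of the bond variables in `U_p`). [folklore] -/
def plaqCurrent (p : Plaq d) : ZdEdge d →₀ ℤ :=
  Finsupp.single (p.1, p.2.1) 1 + Finsupp.single (p.1 + Pi.single p.2.1 1, p.2.2) 1 -
    Finsupp.single (p.1 + Pi.single p.2.2 1, p.2.1) 1 - Finsupp.single (p.1, p.2.2) 1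

/-- `monChar (∂p) U = U_p`, the plaquette holonomy. [folklore] -/
theorem monChar_plaqCurrent_apply (p : Plaq d) (U : ZdGaugeConfig d Circle) :
    monChar (plaqCurrent p) U = U.plaquette p.1 p.2.1 p.2.2 := by
  simp only [plaqCurrent, monChar_sub_apply, monChar_add_apply, monChar_single_apply, zpow_one,
    ZdGaugeConfig.plaquette]

/-- The chain `∑_{t<n} [y + t e_k, · + e_k]` of the straight path of `n` steps in direction `k`
from `y`. [folklore] -/
def lineCurrent (k : Fin d) : ℕ → Literature.Probability.LatticeModels.Site d → (ZdEdge d →₀ ℤ)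
  | 0, _ => 0
  | n + 1, y => Finsupp.single (y, k) 1 + lineCurrent k n (y + Pi.single k 1)

/-- `monChar (lineCurrent k n y) U = U.line k n y`, the straight-path holonomy. [folklore] -/
theorem monChar_lineCurrent_apply (k : Fin d) :
    ∀ (n : ℕ) (y : Literature.Probability.LatticeModels.Site d) (U : ZdGaugeConfig d Circle),
      monChar (lineCurrent k n y) U = U.line k n y
  | 0, y, U => by simp [lineCurrent, ZdGaugeConfig.line]
  | n + 1, y, U => by
    rw [lineCurrent, ZdGaugeConfig.line, monChar_add_apply, monChar_single_apply, zpow_one,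
      monChar_lineCurrent_apply k n]

/-- **The loop current** `J_γ` of the rectangular `R × T` loop `γ` based at `x` in the `(i, j)`
plane: the signed sum of its bonds (Fröhlich–Spencer's `ω_ℒ`, the source of the dual model).
[folklore] -/
def loopCurrent (x : Literature.Probability.LatticeModels.Site d) (i j : Fin d) (R T : ℕ) :
    ZdEdge d →₀ ℤ :=
  lineCurrent i R x + lineCurrent j T (x + Pi.single i (R : ℤ)) -
    lineCurrent i R (x + Pi.single j (T : ℤ)) - lineCurrent j T x

/-- `monChar J_γ U = U_γ`, the rectangular Wilson-loop holonomy. [folklore] -/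
theorem monChar_loopCurrent_apply (x : Literature.Probability.LatticeModels.Site d) (i j : Fin d)
    (R T : ℕ) (U : ZdGaugeConfig d Circle) :
    monChar (loopCurrent x i j R T) U = U.rectangle x i j R T := by
  simp only [loopCurrent, monChar_sub_apply, monChar_add_apply, monChar_lineCurrent_apply,
    ZdGaugeConfig.rectangle]

end Currents

/-! ### The free-boundary `U(1)` theory of `Λ` as a Ginibre model on `(U(1)^{E(ℤ^d)}, dg_∞)` -/

section Model

variable {d : ℕ}

/-- The interaction characters of the `U(1)` theory on `Λ`: one plaquette holonomy per plaquette of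
`Λ`. [folklore] -/
def u1ZdChars (Λ : Finset (Literature.Probability.LatticeModels.Site d)) (p : ↥(plaquettesIn Λ)) :
    ZdGaugeConfig d Circle →ₜ* Circle :=
  monChar (plaqCurrent (p : Plaq d))

/-- `u1ZdChars Λ p U = U_p`. [folklore] -/
@[simp] theorem u1ZdChars_apply (Λ : Finset (Literature.Probability.LatticeModels.Site d))
    (p : ↥(plaquettesIn Λ)) (U : ZdGaugeConfig d Circle) :
    u1ZdChars Λ p U = U.plaquette (p : Plaq d).1 (p : Plaq d).2.1 (p : Plaq d).2.2 :=
  monChar_plaqCurrent_apply _ U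

/-- The Wilson weight of `U(1)` on `Λ` is Ginibre's weight with constant couplings `β`, up to the
constant `e^{-β|P(Λ)|}`: `e^{-β ∑ₚ (1 − Re U_p)} = e^{-β|P(Λ)|} e^{∑ₚ β Re U_p}`. [folklore] -/
theorem exp_neg_mul_zdWilsonAction_u1 (β : ℝ) (Λ : Finset (Literature.Probability.LatticeModels.Site d))
    (U : ZdGaugeConfig d Circle) :
    Real.exp (-β * zdWilsonAction u1Rep Λ U) =
      Real.exp (-β * #(plaquettesIn Λ)) * ginibreWeight (u1ZdChars Λ) (fun _ => β) U := by
  rw [ginibreWeight, ← Real.exp_add]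
  congr 1
  have h1 : zdWilsonAction u1Rep Λ U = #(plaquettesIn Λ) -
      ∑ p ∈ plaquettesIn Λ, ((U.plaquette p.1 p.2.1 p.2.2 : Circle) : ℂ).re := by
    simp only [zdWilsonAction, trace_u1Rep_re, Nat.cast_one, Finset.sum_sub_distrib, Finset.sum_const,
      nsmul_eq_mul, mul_one]
  have h2 : ginibreHamiltonian (u1ZdChars Λ) (fun _ => β) U =
      β * ∑ p ∈ plaquettesIn Λ, ((U.plaquette p.1 p.2.1 p.2.2 : Circle) : ℂ).re := by
    simp only [ginibreHamiltonian, reChar, u1ZdChars_apply, ← Finset.mul_sum]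
    rw [Finset.sum_coe_sort (plaquettesIn Λ)
      (fun p : Plaq d => ((U.plaquette p.1 p.2.1 p.2.2 : Circle) : ℂ).re)]
  rw [h1, h2]
  ring

/-- The `U(1)` Wilson loop is the real part of the loop character. [folklore] -/
theorem zdWilsonLoop_u1Rep (x : Literature.Probability.LatticeModels.Site d) (i j : Fin d) (R T : ℕ)
    (U : ZdGaugeConfig d Circle) :
    zdWilsonLoop u1Rep x i j R T U = reChar (monChar (loopCurrent x i j R T)) U := by
  simp [zdWilsonLoop, reChar, monChar_loopCurrent_apply]

/-- **The free-boundary `U(1)` Wilson-loop expectation on `Λ ⊆ ℤ^d` is a Ginibre expectation** on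
the configuration group with its Haar measure `dg_∞`, characters the plaquette holonomies of `Λ`,
constant couplings `β`, observable `Re U_γ`. [folklore] -/
theorem zdExpect_u1_eq_ginibreExpect (β : ℝ) (Λ : Finset (Literature.Probability.LatticeModels.Site d))
    (x : Literature.Probability.LatticeModels.Site d) (i j : Fin d) (R T : ℕ) :
    zdExpect u1Rep β Λ (zdWilsonLoop u1Rep x i j R T) =
      ginibreExpect (zdHaar d Circle) (u1ZdChars Λ) (fun _ => β)
        (reChar (monChar (loopCurrent x i j R T))) := by
  rw [zdExpect_eq_div_integral u1Rep continuous_u1Rep, ginibreExpect]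
  simp_rw [exp_neg_mul_zdWilsonAction_u1, zdWilsonLoop_u1Rep]
  set c := Real.exp (-β * #(plaquettesIn Λ))
  have hc : c ≠ 0 := (Real.exp_pos _).ne'
  simp_rw [mul_left_comm _ c, integral_const_mul]
  rw [mul_div_mul_left _ _ hc]

/-- The twisted character of the dual expansion is the monomial character of the chain
`J + ∑ₚ mₚ ∂p`. [folklore] -/
theorem twistChar_u1ZdChars (Λ : Finset (Literature.Probability.LatticeModels.Site d))
    (J : ZdEdge d →₀ ℤ) (m : ↥(plaquettesIn Λ) → ℤ) :
    twistChar (u1ZdChars Λ) (monChar J) m = monChar (J + ∑ p, m p • plaqCurrent (p : Plaq d)) := by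
  ext U
  rw [twistChar_apply, monChar_add_apply, monChar_sum_apply]
  simp only [u1ZdChars, monChar_zsmul_apply]

/-- The term `m` of the dual expansion survives iff `J + ∑ₚ mₚ ∂p = 0`. [folklore] -/
theorem twistChar_u1ZdChars_eq_one_iff (Λ : Finset (Literature.Probability.LatticeModels.Site d))
    (J : ZdEdge d →₀ ℤ) (m : ↥(plaquettesIn Λ) → ℤ) :
    twistChar (u1ZdChars Λ) (monChar J) m = 1 ↔ ∑ p, m p • plaqCurrent (p : Plaq d) = -J := by
  rw [twistChar_u1ZdChars, monChar_eq_one_iff, add_comm, add_eq_zero_iff_eq_neg]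

/-- Without source: the term `m` of the dual expansion of the partition function survives iff the
plaquette field is closed, `∑ₚ mₚ ∂p = 0`. [folklore] -/
theorem twistChar_u1ZdChars_one_eq_one_iff (Λ : Finset (Literature.Probability.LatticeModels.Site d))
    (m : ↥(plaquettesIn Λ) → ℤ) :
    twistChar (u1ZdChars Λ) 1 m = 1 ↔ ∑ p, m p • plaqCurrent (p : Plaq d) = 0 := by
  have h := twistChar_u1ZdChars_eq_one_iff Λ 0 m
  rw [neg_zero] at h
  have h0 : monChar (0 : ZdEdge d →₀ ℤ) = 1 := (monChar_eq_one_iff 0).2 rfl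
  rwa [h0] at h

end Model

/-! ### The dual (flux) representation -/

section Dual

variable {d : ℕ}

open Classical in
/-- **The dual (flux) partition function with source `J`**:
`Z_Λ(J) = ∑_{m ∈ ℤ^{P(Λ)}, ∑ₚ mₚ ∂p = J} ∏ₚ I_{mₚ}(β)` — the sum over integer plaquette fields on
`Λ` with boundary current `J`, weighted by the modified Bessel coefficients of the Wilson weight
(Fröhlich–Spencer's `Z_Λ(ℒ)` of the `ℤ`-valued dual model, there with the Villain coefficients
`e^{-n²/2β}`). [cite: CiriglianoPaffuti1999, §1.2 first display (Wilson action: Z(X) = Σ_{n : δn = 0} Π_p I_β(n_p) e^{i(n,X)}); FrohlichSpencerCMP1982 §2.3 (Villain action); MontvayMunster1994 §3.2.7 (3.169)–(3.172)] -/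
def zdU1DualPartition (β : ℝ) (Λ : Finset (Literature.Probability.LatticeModels.Site d))
    (J : ZdEdge d →₀ ℤ) : ℝ :=
  ∑' m : ↥(plaquettesIn Λ) → ℤ,
    if ∑ p, m p • plaqCurrent (p : Plaq d) = J then ∏ p, besselI (m p) β else 0

open Classical in
/-- `Z_Λ(-J) = Z_Λ(J)` (reverse all fluxes; `I_{-m} = I_m`). [folklore] -/
theorem zdU1DualPartition_neg (β : ℝ) (Λ : Finset (Literature.Probability.LatticeModels.Site d))
    (J : ZdEdge d →₀ ℤ) : zdU1DualPartition β Λ (-J) = zdU1DualPartition β Λ J := by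
  unfold zdU1DualPartition
  rw [← (Equiv.neg (↥(plaquettesIn Λ) → ℤ)).tsum_eq]
  refine tsum_congr fun m => ?_
  have hsum : ∑ p, (Equiv.neg _ m) p • plaqCurrent (p : Plaq d) = -∑ p, m p • plaqCurrent (p : Plaq d) := by
    simp [neg_smul, Finset.sum_neg_distrib]
  have hiff : ∑ p, (Equiv.neg _ m) p • plaqCurrent (p : Plaq d) = -J ↔
      ∑ p, m p • plaqCurrent (p : Plaq d) = J := by
    rw [hsum, neg_inj]
  have hprod : ∏ p, besselI ((Equiv.neg _ m) p) β = ∏ p, besselI (m p) β := by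
    simp
  rw [hprod]
  exact if_congr hiff rfl rfl

open Classical in
/-- **The partition function in the dual variables**: `∫ e^{-β S_Λ} dg_∞ = e^{-β|P(Λ)|} Z_Λ(0)`.
[cite: CiriglianoPaffuti1999, §1.2 first display (Wilson action: Z(X) = Σ_{n : δn = 0} Π_p I_β(n_p) e^{i(n,X)}); FrohlichSpencerCMP1982 §2.3 (Villain action); MontvayMunster1994 §3.2.7 (3.169)–(3.172)] -/
theorem integral_exp_neg_mul_zdWilsonAction_u1 (β : ℝ)
    (Λ : Finset (Literature.Probability.LatticeModels.Site d)) :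
    ∫ U, Real.exp (-β * zdWilsonAction u1Rep Λ U) ∂zdHaar d Circle =
      Real.exp (-β * #(plaquettesIn Λ)) * zdU1DualPartition β Λ 0 := by
  simp_rw [exp_neg_mul_zdWilsonAction_u1, integral_const_mul]
  congr 1
  rw [integral_ginibreWeight_eq_tsum, zdU1DualPartition]
  refine tsum_congr fun m => ?_
  exact if_congr (twistChar_u1ZdChars_one_eq_one_iff Λ m) rfl rfl

open Classical in
/-- **The dual (flux) representation of the free-boundary `U(1)` Wilson-loop expectation**
(Fröhlich–Spencer 1982 §2.3 / Guth 1980 §II, here for the Wilson action on an arbitrary finite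
region `Λ ⊆ ℤ^d`): `⟨W_γ⟩_{Λ,β} = Z_Λ(J_γ) / Z_Λ(0)`, where `Z_Λ(J)` sums `∏ₚ I_{mₚ}(β)` over the
integer plaquette fields `m` on `Λ` with `∑ₚ mₚ ∂p = J` and `J_γ = loopCurrent x i j R T` is the
loop current. (If a bond of `γ` lies in no plaquette of `Λ` the constraint is unsolvable and both
sides vanish.) [cite: CiriglianoPaffuti1999, §1.2 first display (Wilson action: Z(X) = Σ_{n : δn = 0} Π_p I_β(n_p) e^{i(n,X)}); FrohlichSpencerCMP1982 §2.3 (Villain action); MontvayMunster1994 §3.2.7 (3.169)–(3.172)] -/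
theorem zdExpect_u1_wilsonLoop_eq_dual (β : ℝ) (Λ : Finset (Literature.Probability.LatticeModels.Site d))
    (x : Literature.Probability.LatticeModels.Site d) (i j : Fin d) (R T : ℕ) :
    zdExpect u1Rep β Λ (zdWilsonLoop u1Rep x i j R T) =
      zdU1DualPartition β Λ (loopCurrent x i j R T) / zdU1DualPartition β Λ 0 := by
  rw [zdExpect_u1_eq_ginibreExpect, ginibreExpect_reChar_eq_tsum_div_tsum,
    ← zdU1DualPartition_neg β Λ (loopCurrent x i j R T)]
  congr 1
  · unfold zdU1DualPartition
    refine tsum_congr fun m => ?_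
    exact if_congr (twistChar_u1ZdChars_eq_one_iff Λ _ m) rfl rfl
  · unfold zdU1DualPartition
    refine tsum_congr fun m => ?_
    exact if_congr (twistChar_u1ZdChars_one_eq_one_iff Λ m) rfl rfl

/-- The dual weights are non-negative for `β ≥ 0`, whence `Z_Λ(J) ≥ 0`. [folklore] -/
theorem zdU1DualPartition_nonneg {β : ℝ} (hβ : 0 ≤ β)
    (Λ : Finset (Literature.Probability.LatticeModels.Site d)) (J : ZdEdge d →₀ ℤ) :
    0 ≤ zdU1DualPartition β Λ J := by
  classical
  unfold zdU1DualPartition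
  refine tsum_nonneg fun m => ?_
  split_ifs
  · exact Finset.prod_nonneg fun p _ => besselI_nonneg hβ _
  · exact le_rfl

/-- `Z_Λ(0) > 0`: it is `e^{β|P(Λ)|} ∫ e^{-βS_Λ} dg_∞`. [folklore] -/
theorem zdU1DualPartition_zero_pos (β : ℝ) (Λ : Finset (Literature.Probability.LatticeModels.Site d)) :
    0 < zdU1DualPartition β Λ 0 := by
  have h := integral_exp_neg_mul_zdWilsonAction_u1 β Λ
  have hpos : 0 < ∫ U, Real.exp (-β * zdWilsonAction u1Rep Λ U) ∂zdHaar d Circle :=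
    integral_exp_pos (integrable_zdHaar_of_continuous (Real.continuous_exp.comp
      (continuous_const.mul (continuous_zdWilsonAction u1Rep continuous_u1Rep Λ))))
  rw [h] at hpos
  exact pos_of_mul_pos_right hpos (Real.exp_pos _).le

end Dual

end Literature.MathematicalPhysics.QuantumFieldTheory
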